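import Summits.CriticalPhenomena.SAWScalingLimit.Theorems.SAWDevelopingMapNoFoldBoundBoundaryLayerCore
import Summits.CriticalPhenomena.SAWScalingLimit.Theorems.SAWDevelopingMapNoFoldBoundLoopWinding
import Summits.CriticalPhenomena.SAWScalingLimit.Theorems.SAWDevelopingMapNoFoldBoundWalledClasses
import Summits.CriticalPhenomena.SAWScalingLimit.Theorems.SAWDevelopingMapNoFoldBoundLocalTurns

/-!
# `NoFoldBound`, line Ideator3Sketch — the boundary layer (registered glue stub)

Crux `NoFoldBound` (stmt-CriticalPhenomena-8296), route `SAWDevelopingMap`, line Ideator3Sketch: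
`stub_boundaryLayer_of` — the leaf stubs W1 (loop winding), W3 (walled ports), W4 (walled
classes), W6 (local turns), A/B (algebra) and the item `SourceLoopBound` (stmt-8300) give ONE
`k < 1` for the no-fold inequality at every vertex of the boundary layer (the source vertex, and
every vertex with a neighbour outside the domain), uniformly over simply connected domains,
sources and labellings: `k = max k_source (β_T/α_T)`. The source vertex is `source_core`
(Core file); walled vertices (card B2, the contact layer, sharp constant `β_T/α_T`) are
`walled_core` below; `stub_boundaryLayer_of` does the labelling bookkeeping.
-/

noncomputable section

open scoped BigOperators
open Literature.Probability.LatticeModels Literature.Probability.RandomPlanarGeometry.SAW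

namespace Summit.CriticalPhenomena.SAWScalingLimit.Theorems.SAWDevelopingMapNoFoldBound

/-! ## Walled vertices -/

/-- **Walled core.** At a vertex `v ∈ Λ` off the source mid-edge with a neighbour `u ∉ Λ` and
other neighbours `p, q`: from the port decomposition (W3), the door-trick classes (W4), the
local turns (W6) and the walled algebra (A), the six labelled no-fold inequalities hold with the
constant `β_T/α_T`. [folklore] -/
theorem walled_core
    (hW3 : ∀ (Λ : Finset HexVertex) (a : Sym2 HexVertex) (u v w₁ w₂ : HexVertex), u ∉ Λ → v ∈ Λ →
      v ∉ a → hexGraph.Adj v u → hexGraph.Adj v w₁ → hexGraph.Adj v w₂ → u ≠ w₁ → u ≠ w₂ →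
      w₁ ≠ w₂ → ∀ (x σ : ℝ),
        hexParafermionicObservable Λ a x σ s(v, u) =
            (x : ℂ) * Complex.exp (-Complex.I * σ *
                (winding [hexMidpoint s(w₁, v), hexCenter v, hexMidpoint s(v, u)] : ℝ)) *
              (∑ γ : HexMidEdgeSAW Λ a s(v, w₁), if v ∉ γ.verts then γ.weight x σ else 0) +
            (x : ℂ) * Complex.exp (-Complex.I * σ *
                (winding [hexMidpoint s(w₂, v), hexCenter v, hexMidpoint s(v, u)] : ℝ)) *
              (∑ γ : HexMidEdgeSAW Λ a s(v, w₂), if v ∉ γ.verts then γ.weight x σ else 0) ∧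
        hexParafermionicObservable Λ a x σ s(v, w₁) =
            (∑ γ : HexMidEdgeSAW Λ a s(v, w₁), if v ∉ γ.verts then γ.weight x σ else 0) +
            (x : ℂ) * Complex.exp (-Complex.I * σ *
                (winding [hexMidpoint s(w₂, v), hexCenter v, hexMidpoint s(v, w₁)] : ℝ)) *
              (∑ γ : HexMidEdgeSAW Λ a s(v, w₂), if v ∉ γ.verts then γ.weight x σ else 0))
    (hW4 : ∀ (Λ : Finset HexVertex), hexDomainSimplyConnected Λ → ∀ a ∈ hexDomainBoundary Λ,
      ∀ (u v : HexVertex), u ∉ Λ → v ∈ Λ → v ∉ a → hexGraph.Adj v u →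
      ∀ (w w' : HexVertex), hexGraph.Adj v w → hexGraph.Adj v w' → w ≠ u → w' ≠ u →
      ∀ (γ : HexMidEdgeSAW Λ a s(v, w)) (γ' : HexMidEdgeSAW Λ a s(v, w')),
        v ∉ γ.verts → v ∉ γ'.verts →
        γ.winding + winding [hexMidpoint s(w, v), hexCenter v, hexMidpoint s(v, u)] =
          γ'.winding + winding [hexMidpoint s(w', v), hexCenter v, hexMidpoint s(v, u)])
    (hW6 : ∀ (v p q r : HexVertex), hexGraph.Adj v p → hexGraph.Adj v q → hexGraph.Adj v r →
      p ≠ q → q ≠ r → p ≠ r →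
      ∃ ε : ℝ, (ε = 1 ∨ ε = -1) ∧
        winding [hexMidpoint s(p, v), hexCenter v, hexMidpoint s(v, q)] = ε * (Real.pi / 3) ∧
        winding [hexMidpoint s(q, v), hexCenter v, hexMidpoint s(v, r)] = ε * (Real.pi / 3) ∧
        winding [hexMidpoint s(r, v), hexCenter v, hexMidpoint s(v, p)] = ε * (Real.pi / 3) ∧
        winding [hexMidpoint s(q, v), hexCenter v, hexMidpoint s(v, p)] = -(ε * (Real.pi / 3)) ∧
        winding [hexMidpoint s(r, v), hexCenter v, hexMidpoint s(v, q)] = -(ε * (Real.pi / 3)) ∧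
        winding [hexMidpoint s(p, v), hexCenter v, hexMidpoint s(v, r)] = -(ε * (Real.pi / 3)))
    (HA : ∀ (ε : ℝ), (ε = 1 ∨ ε = -1) → ∀ (r₁ r₂ : ℝ) (θ : ℂ), 0 ≤ r₁ → 0 ≤ r₂ → ‖θ‖ = 1 →
      let x : ℝ := hexCriticalFugacity
      let e : ℝ → ℂ := fun t => Complex.exp (-Complex.I * (5 / 8 : ℝ) * t)
      let P₁ : ℂ := r₁ * θ
      let P₂ : ℂ := r₂ * θ * Complex.exp (Complex.I * (5 / 8 : ℝ) * (2 * ε * Real.pi / 3 : ℝ))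
      let Fu : ℂ := x * (e (-(ε * (Real.pi / 3))) * P₁ + e (ε * (Real.pi / 3)) * P₂)
      let F₁ : ℂ := P₁ + x * e (-(ε * (Real.pi / 3))) * P₂
      let F₂ : ℂ := P₂ + x * e (ε * (Real.pi / 3)) * P₁
      let ω : ℂ := Complex.exp (2 * Real.pi * Complex.I / 3)
      let k : ℝ := (1 + 2 * hexCriticalFugacity * Real.cos (11 * Real.pi / 24)) /
        (1 + 2 * hexCriticalFugacity * Real.cos (5 * Real.pi / 24))
      let S : ℝ := ‖Fu + F₁ + F₂‖
      ‖Fu + ω * F₁ + ω ^ 2 * F₂‖ ≤ k * S ∧ ‖Fu + ω * F₂ + ω ^ 2 * F₁‖ ≤ k * S ∧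
      ‖F₁ + ω * Fu + ω ^ 2 * F₂‖ ≤ k * S ∧ ‖F₁ + ω * F₂ + ω ^ 2 * Fu‖ ≤ k * S ∧
      ‖F₂ + ω * Fu + ω ^ 2 * F₁‖ ≤ k * S ∧ ‖F₂ + ω * F₁ + ω ^ 2 * Fu‖ ≤ k * S)
    {Λ : Finset HexVertex} (hΛ : hexDomainSimplyConnected Λ) {a : Sym2 HexVertex}
    (ha : a ∈ hexDomainBoundary Λ) {u v p q : HexVertex} (hu : u ∉ Λ) (hv : v ∈ Λ) (hva : v ∉ a)
    (huv : hexGraph.Adj v u) (hp : hexGraph.Adj v p) (hq : hexGraph.Adj v q)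
    (hup : u ≠ p) (huq : u ≠ q) (hpq : p ≠ q) :
    let F : Sym2 HexVertex → ℂ := hexParafermionicObservable Λ a hexCriticalFugacity (5 / 8)
    let ω : ℂ := Complex.exp (2 * Real.pi * Complex.I / 3)
    let k : ℝ := (1 + 2 * hexCriticalFugacity * Real.cos (11 * Real.pi / 24)) /
      (1 + 2 * hexCriticalFugacity * Real.cos (5 * Real.pi / 24))
    let S : ℝ := ‖F s(v, u) + F s(v, p) + F s(v, q)‖
    ‖F s(v, u) + ω * F s(v, p) + ω ^ 2 * F s(v, q)‖ ≤ k * S ∧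
    ‖F s(v, u) + ω * F s(v, q) + ω ^ 2 * F s(v, p)‖ ≤ k * S ∧
    ‖F s(v, p) + ω * F s(v, u) + ω ^ 2 * F s(v, q)‖ ≤ k * S ∧
    ‖F s(v, p) + ω * F s(v, q) + ω ^ 2 * F s(v, u)‖ ≤ k * S ∧
    ‖F s(v, q) + ω * F s(v, u) + ω ^ 2 * F s(v, p)‖ ≤ k * S ∧
    ‖F s(v, q) + ω * F s(v, p) + ω ^ 2 * F s(v, u)‖ ≤ k * S := by
  dsimp only
  -- chirality: cyclic order (p, q, u)
  obtain ⟨ε, hε, Tpq, Tqu, -, -, -, Tpu⟩ := hW6 v p q u hp hq huv hpq huq.symm hup.symm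
  -- port decomposition
  obtain ⟨eFu, eFp⟩ := hW3 Λ a u v p q hu hv hva huv hp hq hup huq hpq hexCriticalFugacity (5 / 8)
  obtain ⟨-, eFq⟩ := hW3 Λ a u v q p hu hv hva huv hq hp huq hup hpq.symm hexCriticalFugacity (5 / 8)
  have Tqp : winding [hexMidpoint s(q, v), hexCenter v, hexMidpoint s(v, p)] =
      -(ε * (Real.pi / 3)) := by
    obtain ⟨ε', -, T1, -, -, T4, -, -⟩ := hW6 v p q u hp hq huv hpq huq.symm hup.symm
    rw [T4, ← T1, Tpq]
  -- the two winding classes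
  have hcls : ∃ Wp : ℝ, (∀ γ : HexMidEdgeSAW Λ a s(v, p), v ∉ γ.verts → γ.winding = Wp) ∧
      (∀ γ' : HexMidEdgeSAW Λ a s(v, q), v ∉ γ'.verts →
        γ'.winding = Wp + -(2 * (ε * (Real.pi / 3)))) := by
    by_cases hP : ∃ γ₀ : HexMidEdgeSAW Λ a s(v, p), v ∉ γ₀.verts
    · obtain ⟨γ₀, hγ₀⟩ := hP
      refine ⟨γ₀.winding, fun γ hγ => ?_, fun γ' hγ' => ?_⟩
      · have h := hW4 Λ hΛ a ha u v hu hv hva huv p p hp hp hup.symm hup.symm γ γ₀ hγ hγ₀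
        linarith
      · have h := hW4 Λ hΛ a ha u v hu hv hva huv p q hp hq hup.symm huq.symm γ₀ γ' hγ₀ hγ'
        rw [Tpu, Tqu] at h
        linarith
    · push Not at hP
      by_cases hQ : ∃ γ₁ : HexMidEdgeSAW Λ a s(v, q), v ∉ γ₁.verts
      · obtain ⟨γ₁, hγ₁⟩ := hQ
        refine ⟨γ₁.winding + 2 * (ε * (Real.pi / 3)), fun γ hγ => (hγ (hP γ)).elim,
          fun γ' hγ' => ?_⟩
        have h := hW4 Λ hΛ a ha u v hu hv hva huv q q hq hq huq.symm huq.symm γ' γ₁ hγ' hγ₁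
        linarith
      · push Not at hQ
        exact ⟨0, fun γ hγ => (hγ (hP γ)).elim, fun γ' hγ' => (hγ' (hQ γ')).elim⟩
  obtain ⟨Wp, hWp, hWq⟩ := hcls
  -- moduli and common phase
  set r₁ : ℝ := ∑ γ : HexMidEdgeSAW Λ a s(v, p),
    if v ∉ γ.verts then hexCriticalFugacity ^ γ.length else 0 with hr₁
  set r₂ : ℝ := ∑ γ : HexMidEdgeSAW Λ a s(v, q),
    if v ∉ γ.verts then hexCriticalFugacity ^ γ.length else 0 with hr₂
  have hr₁0 : 0 ≤ r₁ := sum_ite_pow_nonneg _ nfb_xc_pos.le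
  have hr₂0 : 0 ≤ r₂ := sum_ite_pow_nonneg _ nfb_xc_pos.le
  set θ : ℂ := Complex.exp (-Complex.I * (5 / 8 : ℝ) * (Wp : ℂ)) with hθ
  have hθ1 : ‖θ‖ = 1 := by
    rw [hθ, show -Complex.I * ((5 / 8 : ℝ) : ℂ) * (Wp : ℂ) = ((-(5 / 8 * Wp) : ℝ) : ℂ) * Complex.I by
      push_cast; ring, Complex.norm_exp_ofReal_mul_I]
  have ePp : (∑ γ : HexMidEdgeSAW Λ a s(v, p),
      if v ∉ γ.verts then γ.weight hexCriticalFugacity (5 / 8) else 0) = (r₁ : ℂ) * θ := by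
    rw [sum_firstArrival_eq Wp _ _ hWp, hr₁, hθ, mul_comm]
  have ePq : (∑ γ : HexMidEdgeSAW Λ a s(v, q),
      if v ∉ γ.verts then γ.weight hexCriticalFugacity (5 / 8) else 0) =
      (r₂ : ℂ) * θ * Complex.exp (Complex.I * (5 / 8 : ℝ) * ((2 * ε * Real.pi / 3 : ℝ) : ℂ)) := by
    rw [sum_firstArrival_eq _ _ _ hWq, hr₂, hθ, exp_sub_phase,
      show (2 * (ε * (Real.pi / 3)) : ℝ) = 2 * ε * Real.pi / 3 by ring]
    ring
  have h6 := HA ε hε r₁ r₂ θ hr₁0 hr₂0 hθ1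
  dsimp only at h6
  rw [eFu, eFp, eFq, ePp, ePq, Tpu, Tqu, Tqp, Tpq]
  have e3 : (hexCriticalFugacity : ℂ) *
        Complex.exp (-Complex.I * ((5 / 8 : ℝ) : ℂ) * ((-(ε * (Real.pi / 3)) : ℝ) : ℂ)) *
        ((r₁ : ℂ) * θ) +
      (hexCriticalFugacity : ℂ) *
        Complex.exp (-Complex.I * ((5 / 8 : ℝ) : ℂ) * ((ε * (Real.pi / 3) : ℝ) : ℂ)) *
        ((r₂ : ℂ) * θ * Complex.exp (Complex.I * ((5 / 8 : ℝ) : ℂ) * ((2 * ε * Real.pi / 3 : ℝ) : ℂ))) =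
      (hexCriticalFugacity : ℂ) *
        (Complex.exp (-Complex.I * ((5 / 8 : ℝ) : ℂ) * ((-(ε * (Real.pi / 3)) : ℝ) : ℂ)) *
          ((r₁ : ℂ) * θ) +
        Complex.exp (-Complex.I * ((5 / 8 : ℝ) : ℂ) * ((ε * (Real.pi / 3) : ℝ) : ℂ)) *
          ((r₂ : ℂ) * θ * Complex.exp (Complex.I * ((5 / 8 : ℝ) : ℂ) * ((2 * ε * Real.pi / 3 : ℝ) : ℂ)))) := by
    ring
  rw [e3]
  exact h6

/-- **The boundary layer from the walled port decomposition (W3) and the two algebra stubs (A, B)**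
(lead's glue, hypotheses form; the loop winding W1, the door-trick classes W4 and the local turns
W6 are the landed stubs `stub_loopWinding`, `stub_walledClasses`, `stub_localTurns`): together with
the item `SourceLoopBound` they give ONE `k < 1` (namely `max k_B (β_T/α_T)`) for the no-fold
inequality `‖F₀ + ωF₁ + ω²F₂‖ ≤ k‖F₀ + F₁ + F₂‖` at every vertex of every simply connected domain
that lies on the source mid-edge or has a neighbour outside the domain, for every source and every
labelling of the three neighbours. [folklore] -/
theorem boundaryLayer_of_hyps
    (hW3 : ∀ (Λ : Finset HexVertex) (a : Sym2 HexVertex) (u v w₁ w₂ : HexVertex), u ∉ Λ → v ∈ Λ →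
      v ∉ a → hexGraph.Adj v u → hexGraph.Adj v w₁ → hexGraph.Adj v w₂ → u ≠ w₁ → u ≠ w₂ →
      w₁ ≠ w₂ → ∀ (x σ : ℝ),
        hexParafermionicObservable Λ a x σ s(v, u) =
            (x : ℂ) * Complex.exp (-Complex.I * σ *
                (winding [hexMidpoint s(w₁, v), hexCenter v, hexMidpoint s(v, u)] : ℝ)) *
              (∑ γ : HexMidEdgeSAW Λ a s(v, w₁), if v ∉ γ.verts then γ.weight x σ else 0) +
            (x : ℂ) * Complex.exp (-Complex.I * σ *
                (winding [hexMidpoint s(w₂, v), hexCenter v, hexMidpoint s(v, u)] : ℝ)) *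
              (∑ γ : HexMidEdgeSAW Λ a s(v, w₂), if v ∉ γ.verts then γ.weight x σ else 0) ∧
        hexParafermionicObservable Λ a x σ s(v, w₁) =
            (∑ γ : HexMidEdgeSAW Λ a s(v, w₁), if v ∉ γ.verts then γ.weight x σ else 0) +
            (x : ℂ) * Complex.exp (-Complex.I * σ *
                (winding [hexMidpoint s(w₂, v), hexCenter v, hexMidpoint s(v, w₁)] : ℝ)) *
              (∑ γ : HexMidEdgeSAW Λ a s(v, w₂), if v ∉ γ.verts then γ.weight x σ else 0))
    (hWA : ∀ (ε : ℝ), (ε = 1 ∨ ε = -1) → ∀ (r₁ r₂ : ℝ) (θ : ℂ), 0 ≤ r₁ → 0 ≤ r₂ → ‖θ‖ = 1 →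
      let x : ℝ := hexCriticalFugacity
      let e : ℝ → ℂ := fun t => Complex.exp (-Complex.I * (5 / 8 : ℝ) * t)
      let P₁ : ℂ := r₁ * θ
      let P₂ : ℂ := r₂ * θ * Complex.exp (Complex.I * (5 / 8 : ℝ) * (2 * ε * Real.pi / 3 : ℝ))
      let Fu : ℂ := x * (e (-(ε * (Real.pi / 3))) * P₁ + e (ε * (Real.pi / 3)) * P₂)
      let F₁ : ℂ := P₁ + x * e (-(ε * (Real.pi / 3))) * P₂
      let F₂ : ℂ := P₂ + x * e (ε * (Real.pi / 3)) * P₁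
      let ω : ℂ := Complex.exp (2 * Real.pi * Complex.I / 3)
      let k : ℝ := (1 + 2 * hexCriticalFugacity * Real.cos (11 * Real.pi / 24)) /
        (1 + 2 * hexCriticalFugacity * Real.cos (5 * Real.pi / 24))
      let S : ℝ := ‖Fu + F₁ + F₂‖
      ‖Fu + ω * F₁ + ω ^ 2 * F₂‖ ≤ k * S ∧ ‖Fu + ω * F₂ + ω ^ 2 * F₁‖ ≤ k * S ∧
      ‖F₁ + ω * Fu + ω ^ 2 * F₂‖ ≤ k * S ∧ ‖F₁ + ω * F₂ + ω ^ 2 * Fu‖ ≤ k * S ∧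
      ‖F₂ + ω * Fu + ω ^ 2 * F₁‖ ≤ k * S ∧ ‖F₂ + ω * F₁ + ω ^ 2 * Fu‖ ≤ k * S)
    (hWB : ∀ c : ℝ, c < Real.sin (Real.pi / 8) → ∃ k : ℝ, k < 1 ∧
      ∀ (ε : ℝ), (ε = 1 ∨ ε = -1) → ∀ (Z Z' : ℝ), 0 ≤ Z → Z ≤ c → 0 ≤ Z' → Z' ≤ c →
      let x : ℝ := hexCriticalFugacity
      let e : ℝ → ℂ := fun t => Complex.exp (-Complex.I * (5 / 8 : ℝ) * t)
      let Fu : ℂ := 1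
      let F₁ : ℂ := x * e (ε * (Real.pi / 3)) + x * e (4 * (ε * (Real.pi / 3))) * Z
      let F₂ : ℂ := x * e (-(ε * (Real.pi / 3))) + x * e (4 * (-(ε * (Real.pi / 3)))) * Z'
      let ω : ℂ := Complex.exp (2 * Real.pi * Complex.I / 3)
      let S : ℝ := ‖Fu + F₁ + F₂‖
      ‖Fu + ω * F₁ + ω ^ 2 * F₂‖ ≤ k * S ∧ ‖Fu + ω * F₂ + ω ^ 2 * F₁‖ ≤ k * S ∧
      ‖F₁ + ω * Fu + ω ^ 2 * F₂‖ ≤ k * S ∧ ‖F₁ + ω * F₂ + ω ^ 2 * Fu‖ ≤ k * S ∧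
      ‖F₂ + ω * Fu + ω ^ 2 * F₁‖ ≤ k * S ∧ ‖F₂ + ω * F₁ + ω ^ 2 * Fu‖ ≤ k * S)
    (hSLB : Summit.CriticalPhenomena.SAWScalingLimit.Theses.SAWDevelopingMap.SourceLoopBound) :
    ∃ k : ℝ, k < 1 ∧ ∀ (Λ : Finset HexVertex), hexDomainSimplyConnected Λ →
      ∀ a ∈ hexDomainBoundary Λ, ∀ v ∈ Λ, (v ∈ a ∨ ∃ u : HexVertex, hexGraph.Adj v u ∧ u ∉ Λ) →
      ∀ w₀ w₁ w₂ : HexVertex, hexGraph.Adj v w₀ → hexGraph.Adj v w₁ → hexGraph.Adj v w₂ →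
      w₀ ≠ w₁ → w₁ ≠ w₂ → w₀ ≠ w₂ →
      let F : Sym2 HexVertex → ℂ := hexParafermionicObservable Λ a hexCriticalFugacity (5 / 8)
      let ω : ℂ := Complex.exp (2 * Real.pi * Complex.I / 3)
      ‖F s(v, w₀) + ω * F s(v, w₁) + ω ^ 2 * F s(v, w₂)‖ ≤
        k * ‖F s(v, w₀) + F s(v, w₁) + F s(v, w₂)‖ := by
  -- constants
  obtain ⟨c, hc, hSLBc⟩ := hSLB
  obtain ⟨ks, hks, HB⟩ := hWB c hc
  set kw : ℝ := (1 + 2 * hexCriticalFugacity * Real.cos (11 * Real.pi / 24)) /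
    (1 + 2 * hexCriticalFugacity * Real.cos (5 * Real.pi / 24)) with hkw
  refine ⟨max ks kw, max_lt hks betaT_div_alphaT_lt_one, ?_⟩
  intro Λ hΛ a ha v hv hb w₀ w₁ w₂ h₀ h₁ h₂ h₀₁ h₁₂ h₀₂
  dsimp only
  by_cases hva : v ∈ a
  · -- the source vertex
    have ha₀ := ha
    obtain ⟨haE, u', v', rfl, hv', hu'⟩ := ha
    have hvv' : v = v' := eq_of_mem_boundary_pair hv' hu' hv hva
    subst hvv'
    have huv : hexGraph.Adj v u' := ((SimpleGraph.mem_edgeSet hexGraph).1 haE).symm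
    -- `u'` is one of the three named neighbours; the other two are the ports
    have key : ∀ {p q : HexVertex}, hexGraph.Adj v p → hexGraph.Adj v q → u' ≠ p → u' ≠ q → p ≠ q →
        ∀ {x₀ x₁ x₂ : HexVertex}, (x₀ = u' ∨ x₀ = p ∨ x₀ = q) → (x₁ = u' ∨ x₁ = p ∨ x₁ = q) →
        (x₂ = u' ∨ x₂ = p ∨ x₂ = q) → x₀ ≠ x₁ → x₁ ≠ x₂ → x₀ ≠ x₂ →
        ‖hexParafermionicObservable Λ s(u', v) hexCriticalFugacity (5 / 8) s(v, x₀) +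
            Complex.exp (2 * Real.pi * Complex.I / 3) *
              hexParafermionicObservable Λ s(u', v) hexCriticalFugacity (5 / 8) s(v, x₁) +
            Complex.exp (2 * Real.pi * Complex.I / 3) ^ 2 *
              hexParafermionicObservable Λ s(u', v) hexCriticalFugacity (5 / 8) s(v, x₂)‖ ≤
          max ks kw * ‖hexParafermionicObservable Λ s(u', v) hexCriticalFugacity (5 / 8) s(v, x₀) +
            hexParafermionicObservable Λ s(u', v) hexCriticalFugacity (5 / 8) s(v, x₁) +
            hexParafermionicObservable Λ s(u', v) hexCriticalFugacity (5 / 8) s(v, x₂)‖ := by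
      intro p q hp hq hup huq hpq x₀ x₁ x₂ e₀ e₁ e₂ n₀₁ n₁₂ n₀₂
      have h6 := source_core stub_loopWinding stub_localTurns HB hSLBc hΛ hu' hv huv hp hq hup huq hpq ha₀
      refine (six_labellings
        (fun w => hexParafermionicObservable Λ s(u', v) hexCriticalFugacity (5 / 8) s(v, w))
        u' p q ks h6 e₀ e₁ e₂ n₀₁ n₁₂ n₀₂).trans ?_
      exact mul_le_mul_of_nonneg_right (le_max_left _ _) (norm_nonneg _)
    rcases SourceLoopBound.eq_or_eq_or_eq_of_adj h₀ h₁ h₂ h₀₁ h₀₂ h₁₂ huv with rfl | rfl | rfl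
    · exact key h₁ h₂ h₀₁ h₀₂ h₁₂ (Or.inl rfl) (Or.inr (Or.inl rfl)) (Or.inr (Or.inr rfl)) h₀₁ h₁₂ h₀₂
    · exact key h₀ h₂ h₀₁.symm h₁₂ h₀₂ (Or.inr (Or.inl rfl)) (Or.inl rfl) (Or.inr (Or.inr rfl))
        h₀₁ h₁₂ h₀₂
    · exact key h₀ h₁ h₀₂.symm h₁₂.symm h₀₁ (Or.inr (Or.inl rfl)) (Or.inr (Or.inr rfl)) (Or.inl rfl)
        h₀₁ h₁₂ h₀₂
  · -- a walled vertex off the source mid-edge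
    obtain ⟨u, huv, hu⟩ := hb.resolve_left hva
    have key : ∀ {p q : HexVertex}, hexGraph.Adj v p → hexGraph.Adj v q → u ≠ p → u ≠ q → p ≠ q →
        ∀ {x₀ x₁ x₂ : HexVertex}, (x₀ = u ∨ x₀ = p ∨ x₀ = q) → (x₁ = u ∨ x₁ = p ∨ x₁ = q) →
        (x₂ = u ∨ x₂ = p ∨ x₂ = q) → x₀ ≠ x₁ → x₁ ≠ x₂ → x₀ ≠ x₂ →
        ‖hexParafermionicObservable Λ a hexCriticalFugacity (5 / 8) s(v, x₀) +
            Complex.exp (2 * Real.pi * Complex.I / 3) *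
              hexParafermionicObservable Λ a hexCriticalFugacity (5 / 8) s(v, x₁) +
            Complex.exp (2 * Real.pi * Complex.I / 3) ^ 2 *
              hexParafermionicObservable Λ a hexCriticalFugacity (5 / 8) s(v, x₂)‖ ≤
          max ks kw * ‖hexParafermionicObservable Λ a hexCriticalFugacity (5 / 8) s(v, x₀) +
            hexParafermionicObservable Λ a hexCriticalFugacity (5 / 8) s(v, x₁) +
            hexParafermionicObservable Λ a hexCriticalFugacity (5 / 8) s(v, x₂)‖ := by
      intro p q hp hq hup huq hpq x₀ x₁ x₂ e₀ e₁ e₂ n₀₁ n₁₂ n₀₂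
      have h6 := walled_core hW3 stub_walledClasses stub_localTurns hWA hΛ ha hu hv hva huv hp hq hup huq
        hpq
      refine (six_labellings
        (fun w => hexParafermionicObservable Λ a hexCriticalFugacity (5 / 8) s(v, w))
        u p q kw h6 e₀ e₁ e₂ n₀₁ n₁₂ n₀₂).trans ?_
      exact mul_le_mul_of_nonneg_right (le_max_right _ _) (norm_nonneg _)
    rcases SourceLoopBound.eq_or_eq_or_eq_of_adj h₀ h₁ h₂ h₀₁ h₀₂ h₁₂ huv with rfl | rfl | rfl
    · exact key h₁ h₂ h₀₁ h₀₂ h₁₂ (Or.inl rfl) (Or.inr (Or.inl rfl)) (Or.inr (Or.inr rfl)) h₀₁ h₁₂ h₀₂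
    · exact key h₀ h₂ h₀₁.symm h₁₂ h₀₂ (Or.inr (Or.inl rfl)) (Or.inl rfl) (Or.inr (Or.inr rfl))
        h₀₁ h₁₂ h₀₂
    · exact key h₀ h₁ h₀₂.symm h₁₂.symm h₀₁ (Or.inr (Or.inl rfl)) (Or.inr (Or.inr rfl)) (Or.inl rfl)
        h₀₁ h₁₂ h₀₂

end Summit.CriticalPhenomena.SAWScalingLimit.Theorems.SAWDevelopingMapNoFoldBound
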